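import Summits.BirchSwinnertonDyer.BirchSwinnertonDyer.Theorems.Rank2Observatory2DescClCurveCertE
import HarnessLib

/-!
# BirchSwinnertonDyer — rank ≥ 2 observatory: KERNEL-2DESC-CL v2.3 — the TWO-VIEW per-curve certificate (complex case), part 1/4: records and checkers

HONEST FRAMING: per-curve certified theorems and census instruments; no claim on BSD in rank ≥ 2.

Part 1 of 4 of the two-view per-curve layer (split at the 400-line module cap; declaration text verbatim from the
single-file version).  The mechanism, for the four parts:
monogenic views `ℤ[α]`, `ℤ[η]` of coprime index (`…2DescClEtaCert`, `…2DescClFieldCertE`).  The v2.0 curve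
contract (`ClCurveCert`) names the 2-division root `e` by integral `α`-coordinates and wants a Dedekind–Kummer row
for every prime of `N(F′(e)) = ind(e)²·d_K ⊇` the index primes of `α`, so it is satisfiable only when `ℤ[α] = 𝓞 K`.
Here every element the certificate names — `e`, `D = F′(e)`, and the whole `T`-unit family — is a TWO-VIEW
ELEMENT `x` given by `X = m₁·x ∈ ℤ[α]` and `Y = m₂·x ∈ ℤ[η]` (`m₁ = r₁²` a square, `gcd(m₁, m₂) = 1`,
`twoViewElt`), membership and valuation at a prime above `p` being read in the view whose multiplier is prime to
`p` (`alpha_dispatch` / `eta_dispatch`); since `m₁` is a square, signs, `ord_{W₁}`, `ord_{W₂}` and the residue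
characters of `x` are those of `X`, so the v2.0 parity rows are computed on `X` verbatim.  Support primes are
TAGGED with their view and stored with their family element.  The abstract cover-set theorem
`mordellWeilRank_le_of_coverSet_cl` is applied to the genuine `𝓞 K` elements.  Records `ClFieldCertE2`
(= `ClFieldCertE` + `r₁, m₂` + Bezout), `FamEntry2`, `ClCurveCertE2`; checkers `famCheckE2`, `checkE2 r`;
soundness `rank_le_of_checkE2`; `rank_eq_of_checkE2`; `K`-free row shapes `rank_eq_of_certsE2`,
`rank_eq_of_certsE2_complSq`.  New file only; nothing landed is touched.  Sorry-free; axioms `propext`,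
This part: small algebra, the `η`-registry row and its code primes, the records `ClFieldCertE2` (= `ClFieldCertE` +
`r₁, m₂` + Bezout), `FamEntry2`, `ClCurveCertE2`, and the checkers `famCheckE2`, `checkE2 r`.  New declarations only.
[cite: Cassels1991LecturesEllipticCurves, §15] [cite: CremonaAlgorithms1997, §3.6] [cite: Cohen1993, §4.8.2, §6.2, §6.5]
[cite: SilvermanAEC2009, X.1.1]
-/

set_option linter.dupNamespace false

noncomputable section

open scoped Classical NumberField nonZeroDivisors

open Literature.NumberTheory.NumberFields Polynomial Module NumberField IsDedekindDomain Ideal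

namespace Summit.BirchSwinnertonDyer.BirchSwinnertonDyer.Rank2Observatory.TwoDescCl

open TwoDescCubic ClFieldCert

/-! ## Small algebra -/

section Algebra

variable {K : Type*} [Field K] [NumberField K] {θ : K} {a b c : ℤ}

/-- `lin` is `ℤ`-linear in the coordinates. [folklore] -/
theorem lin_smulCoords (hθ : aeval θ (MonicCubic.poly a b c) = 0) (k : ℤ) (u : ℤ × ℤ × ℤ) :
    lin hθ (smulCoords k u).1 (smulCoords k u).2.1 (smulCoords k u).2.2 = (k : 𝓞 K) * lin hθ u.1 u.2.1 u.2.2 := by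
  apply IsFractionRing.injective (𝓞 K) K
  simp only [smulCoords, algebraMap_lin, map_mul, map_intCast, Int.cast_mul]
  ring

/-- `lin (n, 0, 0) = n`. [folklore] -/
theorem lin_const (hθ : aeval θ (MonicCubic.poly a b c) = 0) (n : ℤ) : lin hθ n 0 0 = (n : 𝓞 K) := by
  apply IsFractionRing.injective (𝓞 K) K
  simp only [algebraMap_lin, map_intCast, Int.cast_zero, zero_mul, add_zero]

end Algebra

/-! ## The `η`-registry row and its code primes -/

namespace ClFieldCertE

variable {K : Type*} [Field K] [NumberField K] {θ : K} (fe : ClFieldCertE)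

/-- The `η`-row of the prime `p` (junk if absent). -/
def rowE (p : ℕ) : PrimeEntry := (fe.primesE.find? fun e => e.p == p).getD ⟨p, 2, (0, 0, 0), (0, 0, 0), [], []⟩

/-- A row of `rowsAt p` lies in the `η`-registry. -/
theorem rowE_mem {p : ℕ} (h : (fe.primesE.any fun e => e.p == p) = true) :
    fe.rowE p ∈ fe.primesE ∧ (fe.rowE p).p = p := by
  unfold rowE
  cases hfind : fe.primesE.find? (fun e => e.p == p) with
  | none =>
    exfalso
    rw [List.find?_eq_none] at hfind
    obtain ⟨e, he, hep⟩ := List.any_eq_true.mp h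
    exact absurd hep (by simpa using hfind e he)
  | some e =>
    simp only [Option.getD_some]
    exact ⟨List.mem_of_find?_eq_some hfind, by simpa using List.find?_some hfind⟩

variable {fe}

/-- The height-one prime of a code certified present in the `η`-registry (junk `W₁` otherwise). -/
def codePrimeEta (hθ : aeval θ (MonicCubic.poly fe.base.a fe.base.b fe.base.c) = 0) (h3 : finrank ℚ K = 3)
    (hE : fe.checkCoreE = true) (hpr : fe.primeListE.Forall Nat.Prime) (C : PCode) : HeightOneSpectrum (𝓞 K) :=
  if h : (fe.primesE.any fun e => e.p == C.1) = true ∧ C ∈ (fe.rowE C.1).codes then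
    primeOfCode (fe.irreducibleE hE) (fe.aeval_eta hθ hE) h3 (e := fe.rowE C.1)
      (fe.prime_of_memE hpr (fe.rowE_mem h.1).1) (fe.rowE_check_of_mem hE (fe.rowE_mem h.1).1).1 h.2
  else fe.base.W₁r hθ h3 (fe.checkReg_of_coreE hE) (fe.base_primeList hpr)

/-- A certified `η`-code prime is presented by its code (in the `η`-view). [folklore] -/
theorem codePrimeEta_asIdeal (hθ : aeval θ (MonicCubic.poly fe.base.a fe.base.b fe.base.c) = 0)
    (h3 : finrank ℚ K = 3) (hE : fe.checkCoreE = true) (hpr : fe.primeListE.Forall Nat.Prime) {C : PCode}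
    (h₁ : (fe.primesE.any fun e => e.p == C.1) = true) (h₂ : C ∈ (fe.rowE C.1).codes) :
    (codePrimeEta hθ h3 hE hpr C).asIdeal = idealOf (fe.aeval_eta hθ hE) C := by
  rw [codePrimeEta, dif_pos ⟨h₁, h₂⟩]
  rfl

end ClFieldCertE

/-! ## Records -/

/-- **Two-view field constants**: the two-view field record plus the multipliers `m₁ = r₁²` (kills
`𝓞 K / ℤ[α]`, a square), `m₂` (kills `𝓞 K / ℤ[η]`) and a Bezout pair `s m₁ + t m₂ = 1`. Pure data. -/
structure ClFieldCertE2 where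
  /-- the two-view field record -/
  fe : ClFieldCertE
  /-- `m₁ = r₁²` -/
  r₁ : ℕ
  /-- the `η`-multiplier -/
  m₂ : ℕ
  /-- Bezout: `s m₁ + t m₂ = 1` -/
  s : ℤ
  /-- Bezout: `s m₁ + t m₂ = 1` -/
  t : ℤ

namespace ClFieldCertE2

/-- `m₁ = r₁²`. -/
def m₁ (F : ClFieldCertE2) : ℕ := F.r₁ ^ 2

/-- **Constants clause**: Bezout, `0 < r₁`, `m₁` prime to `q` and to every `α`-row prime, `m₂` prime to every
`η`-row prime. Computable. -/
def checkConst (F : ClFieldCertE2) : Bool :=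
  bezoutCheck F.s F.t F.m₁ F.m₂ && decide (0 < F.r₁) && decide (Nat.Coprime F.m₁ F.fe.base.q) &&
    (F.fe.base.primes.all fun e => decide (Nat.Coprime F.m₁ e.p)) &&
    (F.fe.primesE.all fun e => decide (Nat.Coprime F.m₂ e.p))

/-- **The complex two-view field checker with constants.** Computable; `decide +kernel` once per field. -/
def check2 (F : ClFieldCertE2) : Bool := F.fe.checkE && F.checkConst

variable (F : ClFieldCertE2)

/-- The two-view field clause of a checked record-with-multipliers. -/
theorem checkE_of_check2 (h : F.check2 = true) : F.fe.checkE = true := by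
  simp only [check2, Bool.and_eq_true] at h; exact h.1

/-- The multiplier/Bezout clause of a checked record-with-multipliers. -/
theorem const_of_check2 (h : F.check2 = true) : F.checkConst = true := by
  simp only [check2, Bool.and_eq_true] at h; exact h.2

/-- The Bezout identity `s·m₁ + t·m₂ = 1` from the constant clause. -/
theorem bezout_of_const (hK : F.checkConst = true) : bezoutCheck F.s F.t F.m₁ F.m₂ = true := by
  simp only [checkConst, Bool.and_eq_true] at hK; exact hK.1.1.1.1

/-- `0 < r₁` from the constant clause. -/
theorem r₁_pos (hK : F.checkConst = true) : 0 < F.r₁ := by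
  simp only [checkConst, Bool.and_eq_true, decide_eq_true_eq] at hK; exact hK.1.1.1.2

/-- `0 < m₁ = r₁²` from the constant clause. -/
theorem m₁_pos (hK : F.checkConst = true) : 0 < F.m₁ := pow_pos (F.r₁_pos hK) 2

/-- `m₂` is prime to the auxiliary prime `q` (constant clause). -/
theorem coprime_q (hK : F.checkConst = true) : Nat.Coprime F.m₁ F.fe.base.q := by
  simp only [checkConst, Bool.and_eq_true, decide_eq_true_eq] at hK; exact hK.1.1.2

/-- `m₂` is prime to every `α`-row prime (constant clause). -/
theorem coprime_row (hK : F.checkConst = true) {e : PrimeEntry} (he : e ∈ F.fe.base.primes) :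
    Nat.Coprime F.m₁ e.p := by
  simp only [checkConst, Bool.and_eq_true, decide_eq_true_eq, List.all_eq_true] at hK; exact hK.1.2 e he

/-- `m₁` is prime to every `η`-row prime (constant clause). -/
theorem coprime_rowE (hK : F.checkConst = true) {e : PrimeEntry} (he : e ∈ F.fe.primesE) :
    Nat.Coprime F.m₂ e.p := by
  simp only [checkConst, Bool.and_eq_true, decide_eq_true_eq, List.all_eq_true] at hK; exact hK.2 e he

end ClFieldCertE2

/-- **A two-view family entry**: `kind` (`1` = the element `q`, anything else generic), `X = m₁x` in
`α`-coordinates, `Y = m₂x` in `η`-coordinates, the sign bit, `e = ord_{W₁}(x)`, the `invCert` datum at `w₂`,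
the factorisation `nf` of `|N(X)|`, and the `invCert` data excluding `x` from non-support code primes in each
view. Pure data. -/
structure FamEntry2 where
  /-- `1` = the element `q`; otherwise generic -/
  kind : ℕ
  /-- `m₁ · x` in `α`-coordinates -/
  X : ℤ × ℤ × ℤ
  /-- `m₂ · x` in `η`-coordinates -/
  Y : ℤ × ℤ × ℤ
  /-- sign bit at the real place (`true` = negative) -/
  sg : Bool
  /-- `ord_{W₁}(x)` -/
  e : ℕ
  /-- `invCert` datum: `X ∉ W₂` -/
  inv2 : ℤ × ℤ × ℤ
  /-- factorisation of `|N(X)|` -/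
  nf : List (ℕ × ℕ)
  /-- `α`-view exclusions `(code, invCert datum)` -/
  invsA : List (PCode × (ℤ × ℤ × ℤ))
  /-- `η`-view exclusions `(code, invCert datum)` -/
  invsE : List (PCode × (ℤ × ℤ × ℤ))

/-- **Two-view per-curve certificate** for `y² = x³ + Ax² + Bx + C`: the 2-division root `e` and `D = F′(e)`
as two-view elements, the factorisation of `|N(X_D)|` with exclusions, the `invCert` data at `w₁, w₂`, the
sieve moduli, the four head entries `−1, ε, γ, q` of the family, and the support codes TAGGED by view
(`true` = `α`) each WITH its family element. Pure data. [cite: Cassels1991LecturesEllipticCurves, §15] -/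
structure ClCurveCertE2 where
  /-- the model `(0, A, 0, B, C)` -/
  A : ℤ
  /-- the model -/
  B : ℤ
  /-- the model -/
  C : ℤ
  /-- irreducibility modulus for `X³ + AX² + BX + C` -/
  pF : ℕ
  /-- `m₁ · e` in `α`-coordinates -/
  Xt : ℤ × ℤ × ℤ
  /-- `m₂ · e` in `η`-coordinates -/
  Yt : ℤ × ℤ × ℤ
  /-- `m₁ · F′(e)` in `α`-coordinates -/
  XD : ℤ × ℤ × ℤ
  /-- `m₂ · F′(e)` in `η`-coordinates -/
  YD : ℤ × ℤ × ℤ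
  /-- factorisation of `|N(X_D)|` -/
  dn : List (ℕ × ℕ)
  /-- `α`-view exclusions for `D` -/
  dinvA : List (PCode × (ℤ × ℤ × ℤ))
  /-- `η`-view exclusions for `D` -/
  dinvE : List (PCode × (ℤ × ℤ × ℤ))
  /-- `invCert` datum: `X_D ∉ W₁` -/
  dW1 : ℤ × ℤ × ℤ
  /-- `invCert` datum: `X_D ∉ W₂` -/
  dW2 : ℤ × ℤ × ℤ
  /-- sieve moduli -/
  Q : List ℕ
  /-- the head of the family: `−1, ε, γ, q` (four entries) -/
  head : List FamEntry2
  /-- the support codes, tagged by view (`true` = `α`), each with its family element -/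
  codes : List ((Bool × PCode) × FamEntry2)

/-! ## The checkers -/

section Checkers

variable (F : ClFieldCertE2) (cc : ClCurveCertE2)

/-- The family: head entries then the code elements. -/
def fam2 : List FamEntry2 := cc.head ++ cc.codes.map Prod.snd

/-- **Prime dispatch**: the rational prime `p` of a norm factorisation is `q`, or has an `α`-row each of whose
codes is a support code or misses the element (`invCert` on `X`), or has an `η`-row likewise (on `Y`). Computable. -/
def primeDispatch (X Y : ℤ × ℤ × ℤ) (invsA invsE : List (PCode × (ℤ × ℤ × ℤ))) (p : ℕ) : Bool :=
  (p == F.fe.base.q) ||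
    ((F.fe.base.primes.any fun e => e.p == p) &&
      ((F.fe.base.row p).codes.all fun C' => decide ((true, C') ∈ cc.codes.map Prod.fst) ||
        invsA.any fun ci => ci.1 == C' && invCert F.fe.base.a F.fe.base.b F.fe.base.c C' X ci.2)) ||
    ((F.fe.primesE.any fun e => e.p == p) &&
      ((F.fe.rowE p).codes.all fun C' => decide ((false, C') ∈ cc.codes.map Prod.fst) ||
        invsE.any fun ci => ci.1 == C' && invCert F.fe.a' F.fe.b' F.fe.c' C' Y ci.2))

/-- **Support-code clause**: the code is present in its view's registry and its prime contains `D`. Computable. -/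
def codeClause (bc : (Bool × PCode) × FamEntry2) : Bool :=
  if bc.1.1 then
    (F.fe.base.primes.any fun e => e.p == bc.1.2.1) && decide (bc.1.2 ∈ (F.fe.base.row bc.1.2.1).codes) &&
      memCode bc.1.2 cc.XD
  else
    (F.fe.primesE.any fun e => e.p == bc.1.2.1) && decide (bc.1.2 ∈ (F.fe.rowE bc.1.2.1).codes) &&
      memCode bc.1.2 cc.YD

/-- Kind-specific clause: the element `q` is literally `X = (m₁ q, 0, 0)`; a generic element misses `W₂` and has
certified `ord_{W₁}`. Computable. -/
def famKindCheck2 (f : FamEntry2) : Bool :=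
  if f.kind = 1 then decide (f.X = ((F.m₁ : ℤ) * F.fe.base.q, 0, 0))
  else invCert F.fe.base.a F.fe.base.b F.fe.base.c F.fe.base.w₂ f.X f.inv2 &&
    ordCheck F.fe.base.q (normFormZ F.fe.base.a F.fe.base.b F.fe.base.c f.X.1 f.X.2.1 f.X.2.2).natAbs f.e

/-- **The two-view family-entry check.** Computable. [cite: Cassels1991LecturesEllipticCurves, §15] -/
def famCheckE2 (f : FamEntry2) : Bool :=
  twoViewCheck F.fe.base.a F.fe.base.b F.fe.base.c F.fe.u F.fe.d F.m₁ F.m₂ f.X f.Y &&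
    signCond F.fe.base.lo F.fe.base.hi f.X f.sg &&
    decide (normFormZ F.fe.base.a F.fe.base.b F.fe.base.c f.X.1 f.X.2.1 f.X.2.2 ≠ 0) &&
    decide (((F.m₁ : ℤ)) ^ 3 ∣ normFormZ F.fe.base.a F.fe.base.b F.fe.base.c f.X.1 f.X.2.1 f.X.2.2) &&
    (F.fe.base.chars.all fun ch => !decide ((ch.1 : ℤ) ∣ evalInt ch.2.1 f.X)) &&
    decide ((normFormZ F.fe.base.a F.fe.base.b F.fe.base.c f.X.1 f.X.2.1 f.X.2.2).natAbs =
      (f.nf.map fun pe => pe.1 ^ pe.2).prod) &&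
    (f.nf.all fun pe => primeDispatch F cc f.X f.Y f.invsA f.invsE pe.1) &&
    famKindCheck2 F f

/-- `log ord_{W₁}`: `−1` for `q`, `−e` otherwise. -/
def famL₁2 (f : FamEntry2) : ℤ := if f.kind = 1 then -1 else -(f.e : ℤ)

/-- `log ord_{W₂}`: `−1` for `q`, `0` otherwise. -/
def famL₂2 (f : FamEntry2) : ℤ := if f.kind = 1 then -1 else 0

/-- Row `k` of the parity matrix at an entry (computed on `X`). -/
def bitRow2 (fc : ClFieldCert) (f : FamEntry2) : ℕ → Bool
  | 0 => f.sg
  | 1 => !decide ((2 : ℤ) ∣ famL₁2 f)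
  | 2 => !decide ((2 : ℤ) ∣ famL₂2 f)
  | k + 3 => eulerBit (fc.chars.getD k (3, 0, 0)).1 (evalInt (fc.chars.getD k (3, 0, 0)).2.1 f.X)

/-- The parity matrix. -/
def bit2 (k : Fin (F.fe.base.chars.length + 3)) (j : Fin (fam2 cc).length) : Bool :=
  bitRow2 F.fe.base ((fam2 cc).get j) k

/-- The norms of the family (`N(x) = N(X) / m₁³`). -/
def famNorm2 (j : Fin (fam2 cc).length) : ℤ :=
  normFormZ F.fe.base.a F.fe.base.b F.fe.base.c ((fam2 cc).get j).X.1 ((fam2 cc).get j).X.2.1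
    ((fam2 cc).get j).X.2.2 / (F.m₁ : ℤ) ^ 3

/-- The sign bits of the family. -/
def famSign2 (j : Fin (fam2 cc).length) : Bool := ((fam2 cc).get j).sg

/-- The sieve. -/
def adm2 (T : Finset (Fin 0)) (U : Finset (Fin (fam2 cc).length)) : Bool :=
  admStdQ cc.Q (fun i : Fin 0 => i.elim0) (famNorm2 F cc) (fun i : Fin 0 => i.elim0) (famSign2 cc) T U &&
    decide (Even (U.filter fun j => bitRow2 F.fe.base ((fam2 cc).get j) 1 = true).card) &&
    decide (Even (U.filter fun j => bitRow2 F.fe.base ((fam2 cc).get j) 2 = true).card)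

/-- **The two-view per-curve `r`-checker.** Computable; run by `decide +kernel`.
[cite: Cassels1991LecturesEllipticCurves, §15] -/
def checkE2 (r : ℕ) : Bool :=
  decide (deltaShort cc.A cc.B cc.C ≠ 0) &&
    noRootMod cc.pF cc.A cc.B cc.C &&
    decide (cubicAtCoords F.fe.base.a F.fe.base.b F.fe.base.c ((F.m₁ : ℤ) * cc.A) ((F.m₁ : ℤ) ^ 2 * cc.B)
      ((F.m₁ : ℤ) ^ 3 * cc.C) cc.Xt = (0, 0, 0)) &&
    decide (derivAtCoords F.fe.base.a F.fe.base.b F.fe.base.c ((F.m₁ : ℤ) * cc.A) ((F.m₁ : ℤ) ^ 2 * cc.B) cc.Xt =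
      MonicCubic.mulCoords F.fe.base.a F.fe.base.b F.fe.base.c (smulCoords (F.m₁ : ℤ) cc.XD)
        (prodPowCoords F.fe.base.a F.fe.base.b F.fe.base.c [])) &&
    twoViewCheck F.fe.base.a F.fe.base.b F.fe.base.c F.fe.u F.fe.d F.m₁ F.m₂ cc.Xt cc.Yt &&
    twoViewCheck F.fe.base.a F.fe.base.b F.fe.base.c F.fe.u F.fe.d F.m₁ F.m₂ cc.XD cc.YD &&
    decide (MonicCubic.disc cc.A cc.B cc.C < 0) &&
    decide (normFormZ F.fe.base.a F.fe.base.b F.fe.base.c cc.XD.1 cc.XD.2.1 cc.XD.2.2 ≠ 0) &&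
    decide ((normFormZ F.fe.base.a F.fe.base.b F.fe.base.c cc.XD.1 cc.XD.2.1 cc.XD.2.2).natAbs =
      (cc.dn.map fun pe => pe.1 ^ pe.2).prod) &&
    (cc.dn.all fun pe => primeDispatch F cc cc.XD cc.YD cc.dinvA cc.dinvE pe.1) &&
    (cc.codes.all fun bc => codeClause F cc bc) &&
    invCert F.fe.base.a F.fe.base.b F.fe.base.c F.fe.base.w₁ cc.XD cc.dW1 &&
    invCert F.fe.base.a F.fe.base.b F.fe.base.c F.fe.base.w₂ cc.XD cc.dW2 &&
    (cc.Q.all fun q => decide (0 < q)) &&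
    decide (cc.head.length = 4) &&
    ((fam2 cc).all fun f => famCheckE2 F cc f) &&
    decide (∀ T : Finset (Fin (fam2 cc).length), T ≠ ∅ →
      ∃ k : Fin (F.fe.base.chars.length + 3), Odd (T.filter fun j => bit2 F cc k j = true).card) &&
    decide (((Finset.univ ×ˢ Finset.univ).filter
      (fun p : Finset (Fin 0) × Finset (Fin (fam2 cc).length) => adm2 F cc p.1 p.2 = true)).card ≤ 2 ^ r)

end Checkers


end Summit.BirchSwinnertonDyer.BirchSwinnertonDyer.Rank2Observatory.TwoDescCl

end
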